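import Summits.ResolutionOfSingularities.ResolutionOfSingularities.Theorems.DescentDescentPerfectToAllResidualWitness
import Mathlib.Algebra.MvPolynomial.Derivation
import Mathlib.Algebra.MvPolynomial.CommRing
import Mathlib.RingTheory.MvPolynomial.Basic
import Mathlib.RingTheory.Localization.FractionRing
import Mathlib.FieldTheory.Perfect
import Mathlib.Algebra.Order.BigOperators.Group.LocallyFinite
import HarnessLib

/-!
# `DescentPerfectToAll` (stmt-ResolutionOfSingularities-0549): Mac Lane's field `S₁` inside a rational function
# field — part 1: the forcing lemma, derivations of `𝔽_p[s₀, s₁, …]`, finite levels, `t_n ∉ 𝓛^p`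

Route `ResolutionOfSingularities/Descent`, crux `DescentPerfectToAll`. Helper (OURS; not a statement of any
manuscript; `--supports` the crux, does not close it). Answers RUNG-B-LIT §11b (res-lit-3, 2026-08-27) offer O1;
part 2 (`DescentDescentPerfectToAllResidualWitnessMacLaneExhaustion`) proves that the field is not EFT-separably
exhausted.

The residual class of the crux (`descentPerfectToAll_iff_residual`: fields of characteristic `p` that are NOT
EFT-separably exhausted) was so far inhabited in the kernel only through a `p`-RANK DEFECT
(`not_exhaustedByEssFiniteType_of_pRank_le[_one]`: `[K : K^p] ≤ p^r` with `r + 1` algebraically independent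
elements — `𝔽_p((X))`, its countable digit-closed subfields). Mac Lane printed in 1939 a field of a different
make [cite: MacLane1939ModularFieldsI, §7 Example (1)] = [cite: MacLane1939SteinitzTowers, §8, field `S₁`,
Lemma 8.4, Lemma 8.5]: over a perfect `P`, `S₁ = P(T, Y)` with `T = {t₀, t₁, …}` algebraically independent and
`y_n^p = t_{n−2} + t_{n−1} t_n^p`; it has infinite `p`-rank and no separating transcendence basis over `P`.
These two files realise `S₁` (for `P = 𝔽_p`, indices shifted by two) INSIDE A RATIONAL FUNCTION FIELD:
the ambient field is `A = Frac(𝔽_p[s₀, s₁, …])` (`FractionRing (MvPolynomial ℕ (ZMod p))`), `t_n := s_n^p`,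
`y_n := s_n + s_{n+1} s_{n+2}^p`, so that `y_n^p = t_n + t_{n+1} t_{n+2}^p` (Mac Lane's equation (1)) and
`𝓛 := Subfield.closure (T ∪ Y) ⊆ A` is (a copy of) `S₁`. This part proves:

* `mem_of_eq_frobenius_add_frobenius_mul` — ABSTRACT FORCING (any field `K` of characteristic `p`, `E ≤ K` with
  `K/E` Mac Lane-separable in the tree's `LinearIndepOn` form): if `a, b ∈ E`, `a = u^p + v^p·b` in `K` and
  `b ∉ K^p`, then `u, v ∈ E` (Mac Lane symmetry `linearIndependent_frobenius_of_macLane` + uniqueness of the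
  `K^p`-coordinates on `{1, b}`);
* `derivation_pow_char_eq_zero`, `derivation_int_pow_char_eq_zero`, `mkDerivation_macLaneY` — the derivations
  `D_c = Σ c_j ∂/∂s_j` of `𝔽_p[s]` kill `p`-th powers (so `T`) and send `y_n ↦ c_n + s_{n+2}^p c_{n+1}`;
* `derivation_eq_zero_of_mem_closure`, `exists_eq_div_of_mem_closure_of_derivation_eq_zero`, `divConst_closure`
  — FRACTION TRICK: every element of the subfield of `Frac R` generated by a set `G ⊆ R` killed by `D` is `a/b`
  with `D a = D b = 0`, and such quotients are closed under the field operations;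
* `macLaneY_pow` — equation (1); `exists_level_of_mem_macLaneField` — every element of `𝓛` has a finite level
  `closure(T ∪ {y_k : k < m})`; `algebraMap_X_not_mem_macLaneField` — `s_n ∉ 𝓛`, i.e. `t_n ∉ 𝓛^p`
  [= MacLane1939SteinitzTowers Lemma 8.4, first clause, re-proved]: the telescoping derivation
  `c_j = (−1)^j ∏_{j+2 ≤ i ≤ m+1} s_i^p` kills `T` and `y_0, …, y_{m−1}` but not `s_n`.

No claim about the crux itself is made; nothing here is a statement of Hironaka's manuscript.
[cite: MacLane1939SteinitzTowers, §8 (1), Lemma 8.4] [cite: MacLane1939ModularFieldsI, §4 Thm 7, Thm 10; §7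
Example (1)] [cite: Matsumura1987, Thm. 26.4]
-/

noncomputable section

set_option linter.dupNamespace false -- mandated namespace of this single-conjunct summit

open MvPolynomial

namespace Summit.ResolutionOfSingularities.ResolutionOfSingularities.Theorems

variable (p : ℕ) [Fact p.Prime]

/-! ## 1 Abstract forcing from Mac Lane separability -/

/-- **Forcing lemma.** Let `K` have characteristic `p`, `E ≤ K` a subfield over which `K` is separable in Mac
Lane's sense (`E`-linearly independent finite families have `E`-linearly independent `p`-th powers). If
`a, b ∈ E` satisfy `a = u^p + v^p·b` with `u, v ∈ K` and `b` is not a `p`-th power in `K`, then `u ∈ E` and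
`v ∈ E`. Proof: `(1, b, a)` cannot be `E^p`-linearly independent (Mac Lane symmetry would make it
`K^p`-independent, against the displayed relation), a dependence must involve `a` (else `b ∈ E^p ⊆ K^p`), so
`a = z₁^p + z₂^p·b` with `zᵢ ∈ E`; comparing with the relation, `(u − z₁)^p + (v − z₂)^p·b = 0` forces `v = z₂`
(else `b ∈ K^p`) and then `u = z₁`. [cite: MacLane1939ModularFieldsI, §4 Thm 7 (iii)]
[cite: Matsumura1987, Thm. 26.4] -/
theorem mem_of_eq_frobenius_add_frobenius_mul {K : Type*} [Field K] [CharP K p] (E : Subfield K)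
    (hML : ∀ u : Finset K, LinearIndepOn E _root_.id (↑u : Set K) →
      LinearIndepOn E (fun x : K => x ^ p) (↑u : Set K))
    {a b u v : K} (ha : a ∈ E) (hb : b ∈ E) (hrel : a = u ^ p + v ^ p * b)
    (hbp : ∀ z : K, z ^ p ≠ b) : u ∈ E ∧ v ∈ E := by
  classical
  have hp : p.Prime := Fact.out
  haveI : CharP E p := E.subtype.charP Subtype.val_injective p
  -- the family `(1, b, a)` of elements of `E`
  let f : Fin 3 → E := ![1, ⟨b, hb⟩, ⟨a, ha⟩]
  have hf0 : ((f 0 : E) : K) = 1 := rfl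
  have hf1 : ((f 1 : E) : K) = b := rfl
  have hf2 : ((f 2 : E) : K) = a := rfl
  -- it is `E^p`-linearly dependent
  have hdep : ¬ LinearIndependent (frobenius E p).fieldRange f := by
    intro hind
    have hK := linearIndependent_frobenius_of_macLane p E hML f hind
    rw [Fintype.linearIndependent_iff] at hK
    let g : Fin 3 → (frobenius K p).fieldRange :=
      ![⟨u ^ p, RingHom.mem_fieldRange.2 ⟨u, rfl⟩⟩, ⟨v ^ p, RingHom.mem_fieldRange.2 ⟨v, rfl⟩⟩,
        ⟨(-1) ^ p, RingHom.mem_fieldRange.2 ⟨-1, rfl⟩⟩]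
    have hsum : ∑ i, g i • ((f i : E) : K) = 0 := by
      rw [Fin.sum_univ_three]
      simp only [Subfield.smul_def, smul_eq_mul, hf0, hf1, hf2]
      show u ^ p * 1 + v ^ p * b + (-1) ^ p * a = 0
      rw [neg_one_pow_char K p, hrel]
      ring
    have h2 := hK g hsum 2
    have h2' : ((-1 : K)) ^ p = 0 := by
      have := congrArg (fun x : (frobenius K p).fieldRange => (x : K)) h2
      exact this
    rw [neg_one_pow_char K p] at h2'
    exact one_ne_zero (neg_eq_zero.mp h2')
  -- extract a dependence with coefficients `w i ^ p`, `w i ∈ E`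
  obtain ⟨g, hg, i₀, hi₀⟩ := Fintype.not_linearIndependent_iff.mp hdep
  have hw : ∀ i, ∃ w : E, w ^ p = (g i : E) := fun i => by
    obtain ⟨w, hw⟩ := RingHom.mem_fieldRange.1 (g i).2
    exact ⟨w, hw⟩
  choose w hw using hw
  have hgK : ∀ i, ((g i : E) : K) = (w i : K) ^ p := fun i => by
    rw [← hw i]; rfl
  have hsumK : (w 0 : K) ^ p + (w 1 : K) ^ p * b + (w 2 : K) ^ p * a = 0 := by
    have := congrArg (fun x : E => (x : K)) hg
    rw [Fin.sum_univ_three] at this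
    simp only [Subfield.smul_def, smul_eq_mul, Subfield.coe_add, Subfield.coe_mul, hf0, hf1, hf2,
      hgK, ZeroMemClass.coe_zero, mul_one] at this
    exact this
  have hwne : ∃ i, (w i : K) ≠ 0 := by
    refine ⟨i₀, fun h => hi₀ ?_⟩
    have : (w i₀ : E) = 0 := by exact_mod_cast h
    apply Subtype.ext
    rw [← hw i₀, this, zero_pow hp.ne_zero]
    rfl
  -- the coefficient of `a` is non-zero
  have hw2 : (w 2 : K) ≠ 0 := by
    intro h2
    rw [h2, zero_pow hp.ne_zero, zero_mul, add_zero] at hsumK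
    by_cases h1 : (w 1 : K) = 0
    · rw [h1, zero_pow hp.ne_zero, zero_mul, add_zero] at hsumK
      have h0 : (w 0 : K) = 0 := (pow_eq_zero_iff hp.ne_zero).mp hsumK
      obtain ⟨i, hi⟩ := hwne
      fin_cases i
      · exact hi h0
      · exact hi h1
      · exact hi h2
    · -- `b = (-(w 0)/(w 1))^p`
      have hw1p : (w 1 : K) ^ p ≠ 0 := pow_ne_zero _ h1
      apply hbp (-(w 0 : K) / (w 1 : K))
      rw [div_pow, neg_pow, neg_one_pow_char K p, neg_one_mul, div_eq_iff hw1p]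
      linear_combination -hsumK
  -- `a = z₁^p + z₂^p b` with `z₁ = -(w 0)/(w 2)`, `z₂ = -(w 1)/(w 2)` in `E`
  set z₁ : K := -(w 0 : K) / (w 2 : K) with hz₁
  set z₂ : K := -(w 1 : K) / (w 2 : K) with hz₂
  have hz₁E : z₁ ∈ E := E.div_mem (E.neg_mem (w 0).2) (w 2).2
  have hz₂E : z₂ ∈ E := E.div_mem (E.neg_mem (w 1).2) (w 2).2
  have ha' : a = z₁ ^ p + z₂ ^ p * b := by
    have hw2p : (w 2 : K) ^ p ≠ 0 := pow_ne_zero _ hw2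
    rw [hz₁, hz₂, div_pow, div_pow, neg_pow, neg_pow (w 1 : K), neg_one_pow_char K p, neg_one_mul,
      neg_one_mul]
    rw [show -((w 0 : K) ^ p) / (w 2 : K) ^ p + -((w 1 : K) ^ p) / (w 2 : K) ^ p * b =
        (-((w 0 : K) ^ p) + -((w 1 : K) ^ p) * b) / (w 2 : K) ^ p by ring]
    rw [eq_div_iff hw2p]
    linear_combination hsumK
  -- compare with the given relation
  have hcmp : (u - z₁) ^ p + (v - z₂) ^ p * b = 0 := by
    rw [sub_pow_char u z₁, sub_pow_char v z₂]
    linear_combination ha' - hrel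
  have hv : v = z₂ := by
    by_contra hne
    have hne' : (v - z₂) ^ p ≠ 0 := pow_ne_zero _ (sub_ne_zero.mpr hne)
    apply hbp (-(u - z₁) / (v - z₂))
    rw [div_pow, neg_pow, neg_one_pow_char K p, neg_one_mul, div_eq_iff hne']
    linear_combination -hcmp
  have hu : u = z₁ := by
    rw [hv, sub_self, zero_pow hp.ne_zero, zero_mul, add_zero] at hcmp
    exact sub_eq_zero.mp ((pow_eq_zero_iff hp.ne_zero).mp hcmp)
  exact ⟨hu ▸ hz₁E, hv ▸ hz₂E⟩

/-! ## 2 Derivations of `𝔽_p[s₀, s₁, …]` and the fraction trick -/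

/-- A derivation `D_c = Σ_j c_j ∂/∂s_j` of `𝔽_p[s]` kills `p`-th powers: `D(q^p) = p·q^{p−1}·D q = 0`.
[folklore] -/
theorem derivation_pow_char_eq_zero (D : Derivation (ZMod p) (MvPolynomial ℕ (ZMod p)) (MvPolynomial ℕ (ZMod p)))
    (q : MvPolynomial ℕ (ZMod p)) : D (q ^ p) = 0 := by
  rw [Derivation.leibniz_pow, ← Nat.cast_smul_eq_nsmul (MvPolynomial ℕ (ZMod p)) p, CharP.cast_eq_zero, zero_smul]

/-- The same for a `ℤ`-derivation of `𝔽_p[s]` (e.g. `D.restrictScalars ℤ`). [folklore] -/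
theorem derivation_int_pow_char_eq_zero (D : Derivation ℤ (MvPolynomial ℕ (ZMod p)) (MvPolynomial ℕ (ZMod p)))
    (q : MvPolynomial ℕ (ZMod p)) : D (q ^ p) = 0 := by
  rw [Derivation.leibniz_pow, ← Nat.cast_smul_eq_nsmul (MvPolynomial ℕ (ZMod p)) p, CharP.cast_eq_zero, zero_smul]

/-- `D_c(y_n) = c_n + s_{n+2}^p·c_{n+1}` for `y_n = s_n + s_{n+1} s_{n+2}^p`. [folklore] -/
theorem mkDerivation_macLaneY (c : ℕ → MvPolynomial ℕ (ZMod p)) (n : ℕ) :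
    mkDerivation (ZMod p) c (X n + X (n + 1) * X (n + 2) ^ p : MvPolynomial ℕ (ZMod p)) =
      c n + X (n + 2) ^ p * c (n + 1) := by
  rw [map_add, Derivation.leibniz, derivation_pow_char_eq_zero, smul_zero, zero_add, mkDerivation_X,
    mkDerivation_X, smul_eq_mul]

/-- A derivation vanishes on the subring generated by elements it kills. [folklore] -/
theorem derivation_eq_zero_of_mem_closure {R : Type*} [CommRing R] {M : Type*} [AddCommGroup M] [Module R M]
    (D : Derivation ℤ R M) (G : Set R) (hG : ∀ g ∈ G, D g = 0) {x : R} (hx : x ∈ Subring.closure G) :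
    D x = 0 := by
  induction hx using Subring.closure_induction with
  | mem x hx => exact hG x hx
  | zero => exact map_zero D
  | one => exact D.map_one_eq_zero
  | add x y _ _ hx hy => rw [map_add, hx, hy, add_zero]
  | neg x _ hx => rw [map_neg, hx, neg_zero]
  | mul x y _ _ hx hy => rw [Derivation.leibniz, hx, hy, smul_zero, smul_zero, add_zero]

/-- **Fraction trick.** If a derivation `D` of a domain `R` kills a set `G`, then every element of the subfield
of `Frac R` generated by `G` is a quotient `a/b` of elements of `R` killed by `D`. [folklore] -/
theorem exists_eq_div_of_mem_closure_of_derivation_eq_zero {R : Type*} [CommRing R] [IsDomain R]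
    {M : Type*} [AddCommGroup M] [Module R M] (D : Derivation ℤ R M) (G : Set R) (hG : ∀ g ∈ G, D g = 0)
    {x : FractionRing R} (hx : x ∈ Subfield.closure (algebraMap R (FractionRing R) '' G)) :
    ∃ a b : R, D a = 0 ∧ D b = 0 ∧ algebraMap R (FractionRing R) a / algebraMap R (FractionRing R) b = x := by
  rw [Subfield.mem_closure_iff] at hx
  obtain ⟨y, hy, z, hz, rfl⟩ := hx
  rw [← RingHom.map_closure] at hy hz
  obtain ⟨a, ha, rfl⟩ := Subring.mem_map.1 hy
  obtain ⟨b, hb, rfl⟩ := Subring.mem_map.1 hz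
  exact ⟨a, b, derivation_eq_zero_of_mem_closure D G hG ha, derivation_eq_zero_of_mem_closure D G hG hb, rfl⟩

/-- The predicate "is a quotient of two `D`-constants of `R`" is closed under the field operations of
`Frac R` and holds on `n`-th powers whenever `D` kills `n`-th powers. [folklore] -/
theorem divConst_closure {R : Type*} [CommRing R] [IsDomain R] {M : Type*} [AddCommGroup M] [Module R M]
    (D : Derivation ℤ R M) (P : FractionRing R → Prop)
    (hP : ∀ x, P x ↔
      ∃ a b : R, D a = 0 ∧ D b = 0 ∧ algebraMap R (FractionRing R) a / algebraMap R (FractionRing R) b = x) :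
    (P 0 ∧ P 1) ∧ (∀ x y, P x → P y → P (x + y)) ∧ (∀ x y, P x → P y → P (x * y)) ∧
      (∀ x, P x → P (-x)) ∧ (∀ x, P x → P x⁻¹) ∧
      (∀ (n : ℕ) (x : FractionRing R), (∀ r : R, D (r ^ n) = 0) → P (x ^ n)) := by
  have f_inj : Function.Injective (algebraMap R (FractionRing R)) := IsFractionRing.injective R _
  refine ⟨⟨(hP 0).2 ⟨0, 1, map_zero D, D.map_one_eq_zero, by simp⟩,
    (hP 1).2 ⟨1, 1, D.map_one_eq_zero, D.map_one_eq_zero, by simp⟩⟩, ?_, ?_, ?_, ?_, ?_⟩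
  · intro x y hx hy
    obtain ⟨a, b, ha, hb, rfl⟩ := (hP x).1 hx
    obtain ⟨a', b', ha', hb', rfl⟩ := (hP y).1 hy
    by_cases hb0 : b = 0
    · refine (hP _).2 ⟨a', b', ha', hb', ?_⟩
      simp [hb0]
    by_cases hb0' : b' = 0
    · refine (hP _).2 ⟨a, b, ha, hb, ?_⟩
      simp [hb0']
    refine (hP _).2 ⟨a * b' + a' * b, b * b', ?_, ?_, ?_⟩
    · rw [map_add, Derivation.leibniz, Derivation.leibniz, ha, hb, ha', hb']; simp
    · rw [Derivation.leibniz, hb, hb']; simp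
    · have h1 : (algebraMap R (FractionRing R)) b ≠ 0 := fun h => hb0 (f_inj (by rw [h, map_zero]))
      have h2 : (algebraMap R (FractionRing R)) b' ≠ 0 := fun h => hb0' (f_inj (by rw [h, map_zero]))
      rw [map_add, map_mul, map_mul, map_mul, div_add_div _ _ h1 h2]
      ring
  · intro x y hx hy
    obtain ⟨a, b, ha, hb, rfl⟩ := (hP x).1 hx
    obtain ⟨a', b', ha', hb', rfl⟩ := (hP y).1 hy
    refine (hP _).2 ⟨a * a', b * b', ?_, ?_, ?_⟩
    · rw [Derivation.leibniz, ha, ha']; simp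
    · rw [Derivation.leibniz, hb, hb']; simp
    · rw [map_mul, map_mul, div_mul_div_comm]
  · intro x hx
    obtain ⟨a, b, ha, hb, rfl⟩ := (hP x).1 hx
    exact (hP _).2 ⟨-a, b, by rw [map_neg, ha, neg_zero], hb, by rw [map_neg, neg_div]⟩
  · intro x hx
    obtain ⟨a, b, ha, hb, rfl⟩ := (hP x).1 hx
    exact (hP _).2 ⟨b, a, hb, ha, by rw [inv_div]⟩
  · intro n x hn
    obtain ⟨a, b, -, rfl⟩ := IsFractionRing.div_surjective (A := R) x
    exact (hP _).2 ⟨a ^ n, b ^ n, hn a, hn b, by rw [map_pow, map_pow, div_pow]⟩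

/-! ## 3 Mac Lane's field inside `Frac(𝔽_p[s₀, s₁, …])` -/

/-- Mac Lane's equation (1) in the ambient rational function field: with `t_n = s_n^p` and
`y_n = s_n + s_{n+1} s_{n+2}^p`, `y_n^p = t_n + t_{n+1}·t_{n+2}^p`, i.e. `t_n = y_n^p + (−t_{n+2})^p·t_{n+1}`.
[cite: MacLane1939SteinitzTowers, §8 (1)] -/
theorem macLaneY_pow (n : ℕ) :
    (algebraMap (MvPolynomial ℕ (ZMod p)) (FractionRing (MvPolynomial ℕ (ZMod p))) (X n) ^ p : _) =
      algebraMap (MvPolynomial ℕ (ZMod p)) (FractionRing (MvPolynomial ℕ (ZMod p))) (X n + X (n + 1) * X (n + 2) ^ p) ^ p +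
        (-(algebraMap (MvPolynomial ℕ (ZMod p)) (FractionRing (MvPolynomial ℕ (ZMod p))) (X (n + 2)) ^ p)) ^ p * algebraMap (MvPolynomial ℕ (ZMod p)) (FractionRing (MvPolynomial ℕ (ZMod p))) (X (n + 1)) ^ p := by
  haveI : CharP (FractionRing (MvPolynomial ℕ (ZMod p))) p :=
    charP_of_injective_algebraMap (IsFractionRing.injective (MvPolynomial ℕ (ZMod p)) _) p
  rw [map_add, map_mul, map_pow, add_pow_char, mul_pow, neg_pow, neg_one_pow_char _ p]
  ring

/-- Every element of `𝓛 = closure(T ∪ Y)` lies in a finite level `closure(T ∪ {y_k : k < m})`. [folklore] -/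
theorem exists_level_of_mem_macLaneField {x : FractionRing (MvPolynomial ℕ (ZMod p))}
    (hx : x ∈ Subfield.closure (algebraMap (MvPolynomial ℕ (ZMod p)) (FractionRing (MvPolynomial ℕ (ZMod p))) '' ({q | ∃ j : ℕ, q = X j ^ p} ∪ {q | ∃ k : ℕ, q = X k + X (k + 1) * X (k + 2) ^ p}))) :
    ∃ m : ℕ, x ∈ Subfield.closure (algebraMap (MvPolynomial ℕ (ZMod p)) (FractionRing (MvPolynomial ℕ (ZMod p))) '' ({q | ∃ j : ℕ, q = X j ^ p} ∪ {q | ∃ k : ℕ, k < m ∧ q = X k + X (k + 1) * X (k + 2) ^ p})) := by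
  have hmono : ∀ {m m' : ℕ}, m ≤ m' →
      Subfield.closure (algebraMap (MvPolynomial ℕ (ZMod p)) (FractionRing (MvPolynomial ℕ (ZMod p))) ''
        ({q | ∃ j : ℕ, q = X j ^ p} ∪ {q | ∃ k : ℕ, k < m ∧ q = X k + X (k + 1) * X (k + 2) ^ p})) ≤
      Subfield.closure (algebraMap (MvPolynomial ℕ (ZMod p)) (FractionRing (MvPolynomial ℕ (ZMod p))) ''
        ({q | ∃ j : ℕ, q = X j ^ p} ∪ {q | ∃ k : ℕ, k < m' ∧ q = X k + X (k + 1) * X (k + 2) ^ p})) := by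
    intro m m' hmm'
    apply Subfield.closure_mono
    apply Set.image_mono
    apply Set.union_subset_union_right
    rintro q ⟨k, hk, rfl⟩
    exact ⟨k, lt_of_lt_of_le hk hmm', rfl⟩
  induction hx using Subfield.closure_induction with
  | mem x hx =>
    obtain ⟨q, hq, rfl⟩ := hx
    rcases hq with ⟨j, rfl⟩ | ⟨k, rfl⟩
    · exact ⟨0, Subfield.subset_closure ⟨_, Or.inl ⟨j, rfl⟩, rfl⟩⟩
    · exact ⟨k + 1, Subfield.subset_closure ⟨_, Or.inr ⟨k, Nat.lt_succ_self k, rfl⟩, rfl⟩⟩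
  | one => exact ⟨0, Subfield.one_mem _⟩
  | add x y _ _ hx hy =>
    obtain ⟨m, hm⟩ := hx
    obtain ⟨m', hm'⟩ := hy
    exact ⟨max m m', Subfield.add_mem _ (hmono (le_max_left _ _) hm) (hmono (le_max_right _ _) hm')⟩
  | neg x _ hx =>
    obtain ⟨m, hm⟩ := hx
    exact ⟨m, Subfield.neg_mem _ hm⟩
  | inv x _ hx =>
    obtain ⟨m, hm⟩ := hx
    exact ⟨m, Subfield.inv_mem _ hm⟩
  | mul x y _ _ hx hy =>
    obtain ⟨m, hm⟩ := hx
    obtain ⟨m', hm'⟩ := hy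
    exact ⟨max m m', Subfield.mul_mem _ (hmono (le_max_left _ _) hm) (hmono (le_max_right _ _) hm')⟩

/-- **`s_n ∉ 𝓛`** (equivalently `t_n = s_n^p` is not a `p`-th power in `𝓛 = 𝔽_p(T, Y)`): an element of `𝓛`
lies in `closure(T ∪ {y_k : k < m})` for some `m ≥ n`; the derivation with `c_j = (−1)^j ∏_{i=j+2}^{m+1} s_i^p`
(`j ≤ m`, else `0`) kills `T` and these `y_k` (telescoping), so every element of that subfield is `a/b` with
`D a = D b = 0`, whereas `D s_n = c_n ≠ 0`. [cite: MacLane1939SteinitzTowers, §8 Lemma 8.4] -/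
theorem algebraMap_X_not_mem_macLaneField (n : ℕ) :
    algebraMap (MvPolynomial ℕ (ZMod p)) (FractionRing (MvPolynomial ℕ (ZMod p))) (X n) ∉ Subfield.closure (algebraMap (MvPolynomial ℕ (ZMod p)) (FractionRing (MvPolynomial ℕ (ZMod p))) '' ({q | ∃ j : ℕ, q = X j ^ p} ∪ {q | ∃ k : ℕ, q = X k + X (k + 1) * X (k + 2) ^ p})) := by
  classical
  have hp : p.Prime := Fact.out
  have f_inj : Function.Injective (algebraMap (MvPolynomial ℕ (ZMod p)) (FractionRing (MvPolynomial ℕ (ZMod p)))) := IsFractionRing.injective _ _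
  intro hmem
  -- Step 1: a finite level `m ≥ n`
  obtain ⟨m₀, hm₀⟩ := exists_level_of_mem_macLaneField p hmem
  set m := max m₀ n with hmdef
  have hmn : n ≤ m := le_max_right _ _
  have hm : algebraMap (MvPolynomial ℕ (ZMod p)) (FractionRing (MvPolynomial ℕ (ZMod p))) (X n) ∈ Subfield.closure (algebraMap (MvPolynomial ℕ (ZMod p)) (FractionRing (MvPolynomial ℕ (ZMod p))) '' ({q | ∃ j : ℕ, q = X j ^ p} ∪ {q | ∃ k : ℕ, k < m ∧ q = X k + X (k + 1) * X (k + 2) ^ p})) := by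
    refine Subfield.closure_mono (Set.image_mono (Set.union_subset_union_right _ ?_)) hm₀
    rintro q ⟨k, hk, rfl⟩
    exact ⟨k, lt_of_lt_of_le hk (le_max_left _ _), rfl⟩
  -- Step 2: the telescoping derivation
  let c : ℕ → MvPolynomial ℕ (ZMod p) := fun j =>
    if j ≤ m then (-1) ^ j * ∏ i ∈ Finset.Ico (j + 2) (m + 2), X i ^ p else 0
  let D := mkDerivation (ZMod p) c
  have hcY : ∀ k, k < m → c k + X (k + 2) ^ p * c (k + 1) = 0 := by
    intro k hk
    have hk1 : k ≤ m := hk.le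
    have hk2 : k + 1 ≤ m := hk
    simp only [c, if_pos hk1, if_pos hk2]
    rw [Finset.prod_eq_prod_Ico_succ_bot (show k + 2 < m + 2 by omega)]
    rw [show k + 1 + 2 = k + 2 + 1 by ring, pow_succ]
    ring
  have hDT : ∀ j : ℕ, D (X j ^ p) = 0 := fun j => derivation_pow_char_eq_zero p D _
  have hDY : ∀ k, k < m → D (X k + X (k + 1) * X (k + 2) ^ p) = 0 := fun k hk => by
    show mkDerivation (ZMod p) c _ = 0
    rw [mkDerivation_macLaneY, hcY k hk]
  have hDn : D (X n) ≠ 0 := by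
    show mkDerivation (ZMod p) c (X n) ≠ 0
    rw [mkDerivation_X]
    simp only [c, if_pos hmn]
    refine mul_ne_zero (pow_ne_zero _ (neg_ne_zero.mpr one_ne_zero)) ?_
    rw [Finset.prod_ne_zero_iff]
    intro i _
    exact pow_ne_zero _ (X_ne_zero i)
  -- Step 3: fraction trick
  have hG : ∀ g ∈ ({q | ∃ j : ℕ, q = X j ^ p} ∪ {q | ∃ k : ℕ, k < m ∧ q = X k + X (k + 1) * X (k + 2) ^ p} : Set (MvPolynomial ℕ (ZMod p))),
      (D.restrictScalars ℤ) g = 0 := by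
    rintro g (⟨j, rfl⟩ | ⟨k, hk, rfl⟩)
    · exact hDT j
    · exact hDY k hk
  obtain ⟨a, b, ha, hb, hab⟩ :=
    exists_eq_div_of_mem_closure_of_derivation_eq_zero (D.restrictScalars ℤ) _ hG hm
  have ha' : D a = 0 := ha
  have hb' : D b = 0 := hb
  by_cases hb0 : b = 0
  · rw [hb0, map_zero, div_zero] at hab
    exact X_ne_zero n (f_inj (by rw [map_zero]; exact hab.symm))
  · have hfb : algebraMap (MvPolynomial ℕ (ZMod p)) (FractionRing (MvPolynomial ℕ (ZMod p))) b ≠ 0 := fun h => hb0 (f_inj (by rw [h, map_zero]))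
    have hXb : X n * b = a := f_inj (by rw [map_mul, ← hab, div_mul_cancel₀ _ hfb])
    have := congrArg D hXb
    rw [Derivation.leibniz, hb', smul_zero, zero_add, ha', smul_eq_mul] at this
    exact hb0 ((mul_eq_zero.mp this).resolve_right hDn)

end Summit.ResolutionOfSingularities.ResolutionOfSingularities.Theorems

end
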